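import Summits.Parity.GeneralizedHardyLittlewood.Theorems.BeyondDiagonalBeatsQuarter.OffDiagDualLedgerRow
import Summits.Parity.GeneralizedHardyLittlewood.Theorems.BeyondDiagonalBeatsQuarter.OffDiagTailsMollified
import HarnessLib

/-!
# Route `PrimeLevelFamEdge`, crux K_B (stmt-Parity-20343), line `diagonal_kernel_split` rev 4, plan Ω,
# worker key L3 (part 6e, scales) `OffDiagDualLedgerScales`: the row constant of the trivial ledger AT THE
# SCALES OF THE HEART — `M = q̂^{Δ′}`, `R = q⁷`, `y₀ = log⁴q`, `Λ = (Λ₀+1)²log⁴q`, `Q = q^{ε₀}`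

`OffDiagDualLedgerRow` / `OffDiagDualLedgerTotal` bound the trivial ledger of the finite dual core for arbitrary
parameters. This file evaluates the row constant `ledgerRow` at the scales of the heart:
* `exists_mul_log_pow_le_rpow` — `K(log q)^k ≤ q^ε` eventually; `mul_le_of_coordinatewise` — coordinatewise
  dual heights `a_j ≤ Λ₀X/K_j + 1` satisfy the product condition of the ledger with `Λ = (Λ₀+1)²L` once
  `K₁K₂ ≤ qL ≤ XL` (near boxes);
* `ledgerZ_scales_eq` — `Z_b(q, q̂^{Δ′}, log⁴q) = (2/π)·q̂^{Δ′−1}·log²q`; `natLog_floor_sq_le` — the number of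
  near boxes `(log₂⌊4q̂²log⁴q⌋+1)² ≤ 121 log²q`; `qhat_le_log_sq_mul_mainScaleReal` — `q̂ ≤ log²q·ms`;
* `ledger_rpow_factor_le` (`(Λ(q·q⁷)²(1+Z_b)²Q²)^δ ≤ 4(Λ₀+1)²q^{27δ}`), `ledger_density_factor_le`
  (`2ΛQ²(1+Z_b)^{1/2} + 4q̂²log⁴q/q ≤ (4(Λ₀+1)²+1)log⁵q·Q²·q̂^{(Δ′−1)/2}`), **`ledgerRow_scales_le`**:
  `ledgerRow ≤ 2520π·(2C·4(Λ₀+1)²q^{27δ})·((4(Λ₀+1)²+1)log⁵q·q^{2ε₀}·q̂^{(Δ′−1)/2})` — the factor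
  `q̂^{(Δ′−1)/2} = (1+Z_b)^{1/2}` is the dual density that makes the trivial exponent `κ₀ = 5/4`.
The assembly with the total (`dualLedgerTotal_scales_le`, `≤ q^{(5/4)(Δ′−1)+2ε₀+ε}·ms`) is
`OffDiagDualLedgerMainScale`. Elementary bookkeeping; nothing about the heart.
Helper (`--supports stmt-Parity-20343`); standard axioms.
«The programme SEARCHES and TYPES; no claim about Landau–Siegel zeros, Theorems 1–2 of arXiv:2211.02515 or
a repaired Margin232 until a kernel theorem says so.»
-/

noncomputable section

open Finset Polynomial
open scoped Real

namespace Summit.Parity.GeneralizedHardyLittlewood.Theorems.BeyondDiagonalBeatsQuarter.OffDiag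

open Literature.NumberTheory.LFunctions Literature.NumberTheory.LFunctions.KMV2000
open PeterssonSplit (two_pi_mul_qhat_sq qhat_sq_le)

/-! ### §1. Real-variable tools -/

/-- **Logarithms lose to every power**: for `K ≥ 0`, `ε > 0`, `k ∈ ℕ` there is `q₀` with `K·(log q)^k ≤ q^ε`
for all `q ≥ q₀` (`log q ≤ q^a/a`, `a = ε/(2(k+1))`). [folklore] -/
theorem exists_mul_log_pow_le_rpow {K ε : ℝ} (hK : 0 ≤ K) (hε : 0 < ε) (k : ℕ) :
    ∃ q₀ : ℕ, ∀ q : ℕ, q₀ ≤ q → K * Real.log q ^ k ≤ (q : ℝ) ^ ε := by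
  set a : ℝ := ε / (2 * (k + 1)) with ha
  have ha0 : 0 < a := by positivity
  set B : ℝ := K * a⁻¹ ^ k with hB
  have hB0 : 0 ≤ B := by positivity
  refine ⟨⌈B ^ (2 / ε)⌉₊ + 1, fun q hq ↦ ?_⟩
  have hq1' : 1 ≤ q := le_trans (Nat.le_add_left 1 _) hq
  have hq1 : (1 : ℝ) ≤ q := by exact_mod_cast hq1'
  have hq0 : (0 : ℝ) < q := lt_of_lt_of_le one_pos hq1
  have hlog0 : 0 ≤ Real.log q := Real.log_nonneg hq1
  have hlog : Real.log q ≤ (q : ℝ) ^ a / a := Real.log_le_rpow_div hq0.le ha0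
  have h1 : Real.log q ^ k ≤ ((q : ℝ) ^ a / a) ^ k := pow_le_pow_left₀ hlog0 hlog k
  have h2 : ((q : ℝ) ^ a / a) ^ k = (q : ℝ) ^ (a * k) * a⁻¹ ^ k := by
    rw [div_eq_mul_inv, mul_pow, ← Real.rpow_natCast ((q : ℝ) ^ a) k, ← Real.rpow_mul hq0.le]
  have hak : a * k ≤ ε / 2 := by
    have hk : (k : ℝ) / (k + 1) ≤ 1 := (div_le_one (by positivity)).2 (by linarith)
    calc a * k = ε / 2 * ((k : ℝ) / (k + 1)) := by rw [ha]; field_simp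
      _ ≤ ε / 2 * 1 := by gcongr
      _ = ε / 2 := mul_one _
  have h3 : (q : ℝ) ^ (a * k) ≤ (q : ℝ) ^ (ε / 2) := Real.rpow_le_rpow_of_exponent_le hq1 hak
  have h4 : B ≤ (q : ℝ) ^ (ε / 2) := by
    have hqB : B ^ (2 / ε) ≤ q :=
      calc B ^ (2 / ε) ≤ ⌈B ^ (2 / ε)⌉₊ := Nat.le_ceil _
        _ ≤ q := by exact_mod_cast le_trans (Nat.le_succ _) hq
    calc B = (B ^ (2 / ε)) ^ (ε / 2) := by
          rw [← Real.rpow_mul hB0, show (2 / ε) * (ε / 2) = (1 : ℝ) by field_simp, Real.rpow_one]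
      _ ≤ (q : ℝ) ^ (ε / 2) := Real.rpow_le_rpow (by positivity) hqB (by positivity)
  calc K * Real.log q ^ k ≤ K * (((q : ℝ) ^ a / a) ^ k) := mul_le_mul_of_nonneg_left h1 hK
    _ = B * (q : ℝ) ^ (a * k) := by rw [h2, hB]; ring
    _ ≤ (q : ℝ) ^ (ε / 2) * (q : ℝ) ^ (ε / 2) := mul_le_mul h4 h3 (by positivity) (by positivity)
    _ = (q : ℝ) ^ ε := by rw [← Real.rpow_add hq0]; ring_nf

/-- **Coordinatewise heights are admissible**: if `a_j ≤ Λ₀X/K_j + 1` (`j = 1,2`) with `K_j ≥ 1`, `K₁K₂ ≤ qL`,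
`1 ≤ q ≤ X`, `L ≥ 1`, then `a₁a₂ ≤ (Λ₀+1)²L·X²/(K₁K₂)`. [folklore] -/
theorem mul_le_of_coordinatewise {a₁ a₂ Λ₀ X K₁ K₂ L q : ℝ} (ha₂ : 0 ≤ a₂) (hΛ₀ : 0 ≤ Λ₀)
    (hK₁ : 1 ≤ K₁) (hK₂ : 1 ≤ K₂) (hL : 1 ≤ L) (hq : 1 ≤ q) (hqX : q ≤ X) (hKK : K₁ * K₂ ≤ q * L)
    (h₁ : a₁ ≤ Λ₀ * X / K₁ + 1) (h₂ : a₂ ≤ Λ₀ * X / K₂ + 1) :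
    a₁ * a₂ ≤ (Λ₀ + 1) ^ 2 * L * (X ^ 2 / (K₁ * K₂)) := by
  have hX : 1 ≤ X := hq.trans hqX
  have hK₁0 : 0 < K₁ := by linarith
  have hK₂0 : 0 < K₂ := by linarith
  have hL0 : 0 ≤ L := by linarith
  have hb₁ : a₁ * K₁ ≤ Λ₀ * X + K₁ := by
    have := mul_le_mul_of_nonneg_right h₁ hK₁0.le
    rwa [add_mul, one_mul, div_mul_cancel₀ _ hK₁0.ne'] at this
  have hb₂ : a₂ * K₂ ≤ Λ₀ * X + K₂ := by
    have := mul_le_mul_of_nonneg_right h₂ hK₂0.le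
    rwa [add_mul, one_mul, div_mul_cancel₀ _ hK₂0.ne'] at this
  have hqL : q * L ≤ X * L := mul_le_mul_of_nonneg_right hqX hL0
  have hK₁b : K₁ ≤ X * L := (le_mul_of_one_le_right hK₁0.le hK₂).trans (hKK.trans hqL)
  have hK₂b : K₂ ≤ X * L := (le_mul_of_one_le_left hK₂0.le hK₁).trans (hKK.trans hqL)
  have hKKb : K₁ * K₂ ≤ X ^ 2 * L := by
    refine hKK.trans (hqL.trans ?_)
    rw [sq, mul_assoc]
    exact le_mul_of_one_le_left (by positivity) hX
  have hΛX : 0 ≤ Λ₀ * X := by positivity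
  have hmain : a₁ * a₂ * (K₁ * K₂) ≤ (Λ₀ + 1) ^ 2 * L * X ^ 2 := by
    have h0 : Λ₀ ^ 2 * X ^ 2 ≤ Λ₀ ^ 2 * X ^ 2 * L := le_mul_of_one_le_right (by positivity) hL
    calc a₁ * a₂ * (K₁ * K₂) = (a₁ * K₁) * (a₂ * K₂) := by ring
      _ ≤ (Λ₀ * X + K₁) * (Λ₀ * X + K₂) := mul_le_mul hb₁ hb₂ (by positivity) (by positivity)
      _ = Λ₀ ^ 2 * X ^ 2 + Λ₀ * X * K₁ + Λ₀ * X * K₂ + K₁ * K₂ := by ring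
      _ ≤ Λ₀ ^ 2 * X ^ 2 * L + Λ₀ * X * (X * L) + Λ₀ * X * (X * L) + X ^ 2 * L :=
          add_le_add (add_le_add (add_le_add h0 (mul_le_mul_of_nonneg_left hK₁b hΛX))
            (mul_le_mul_of_nonneg_left hK₂b hΛX)) hKKb
      _ = (Λ₀ + 1) ^ 2 * L * X ^ 2 := by ring
  rw [show (Λ₀ + 1) ^ 2 * L * (X ^ 2 / (K₁ * K₂)) = (Λ₀ + 1) ^ 2 * L * X ^ 2 / (K₁ * K₂) by ring,
    le_div_iff₀ (by positivity)]
  exact hmain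

/-! ### §2. The scales of the heart -/

variable {q : ℕ}

/-- `log q ≥ 1` for `q ≥ 40`. [folklore] -/
theorem one_le_log (hq : 40 ≤ q) : 1 ≤ Real.log q := by
  have hq0 : (0 : ℝ) < q := by exact_mod_cast (show 0 < q by omega)
  rw [Real.le_log_iff_exp_le hq0]
  have h40 : (40 : ℝ) ≤ q := by exact_mod_cast hq
  linarith [Real.exp_one_lt_d9]

/-- The uniform Bessel scale at the clean scales: `Z_b(q, q̂^{Δ′}, log⁴q) = (2/π)·q̂^{Δ′−1}·log²q`.
[cite: KowalskiMichelVanderKam2000, (21)–(23) p. 12 — derivation] -/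
theorem ledgerZ_scales_eq (hq : 40 ≤ q) (Δ' : ℝ) :
    ledgerZ q (qhat q ^ Δ') (Real.log q ^ 4) = 2 / π * qhat q ^ (Δ' - 1) * Real.log q ^ 2 := by
  have hs0 : 0 < qhat q := lt_trans one_pos (one_lt_qhat hq)
  have hL0 : 0 ≤ Real.log q := Real.log_nonneg (by exact_mod_cast (show 1 ≤ q by omega))
  have hM0 : 0 ≤ qhat q ^ Δ' := Real.rpow_nonneg hs0.le _
  unfold ledgerZ
  have hsq : (qhat q ^ Δ') ^ 2 * (4 * qhat q ^ 2 * Real.log q ^ 4) =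
      (2 * qhat q ^ Δ' * qhat q * Real.log q ^ 2) ^ 2 := by ring
  rw [hsq, Real.sqrt_sq (by positivity), ← two_pi_mul_qhat_sq q, Real.rpow_sub_one hs0.ne']
  field_simp
  ring

/-- The number of near boxes at the clean scales: `(log₂⌊4q̂²log⁴q⌋ + 1)² ≤ 121·log²q` for `q ≥ 40`.
[folklore] -/
theorem natLog_floor_sq_le (hq : 40 ≤ q) :
    ((((Nat.log 2 ⌊4 * qhat q ^ 2 * Real.log q ^ 4⌋₊ + 1) ^ 2 : ℕ)) : ℝ) ≤ 121 * Real.log q ^ 2 := by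
  have hq0 : (0 : ℝ) < q := by exact_mod_cast (show 0 < q by omega)
  have hL1 : 1 ≤ Real.log q := one_le_log hq
  have hL0 : 0 < Real.log q := lt_of_lt_of_le one_pos hL1
  set L : ℝ := Real.log q with hL
  set T : ℕ := ⌊4 * qhat q ^ 2 * L ^ 4⌋₊ with hT
  set k : ℕ := Nat.log 2 T with hk
  -- `k ≤ 10 L`
  have hk10 : (k : ℝ) ≤ 10 * L := by
    rcases Nat.eq_zero_or_pos T with hT0 | hTpos
    · have : k = 0 := by rw [hk, hT0, Nat.log_zero_right]
      rw [this, Nat.cast_zero]; positivity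
    · have h2k : ((2 : ℕ) ^ k : ℕ) ≤ T := Nat.pow_log_le_self 2 hTpos.ne'
      have h4s : 4 * qhat q ^ 2 ≤ (q : ℝ) := by
        rw [← two_pi_mul_qhat_sq q, show (2 * π * qhat q) ^ 2 = π ^ 2 * (4 * qhat q ^ 2) by ring]
        have hπ : (1 : ℝ) ≤ π ^ 2 := by nlinarith [Real.pi_gt_three]
        exact le_mul_of_one_le_left (by positivity) hπ
      have hTle : (T : ℝ) ≤ (q : ℝ) * L ^ 4 :=
        (Nat.floor_le (by positivity)).trans (mul_le_mul_of_nonneg_right h4s (by positivity))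
      have h2kR : (2 : ℝ) ^ k ≤ (q : ℝ) * L ^ 4 := le_trans (by exact_mod_cast h2k) hTle
      have hlog2k : (k : ℝ) * Real.log 2 ≤ L + 4 * Real.log L := by
        have := Real.log_le_log (by positivity) h2kR
        rwa [Real.log_pow, Real.log_mul hq0.ne' (by positivity), Real.log_pow] at this
      have hlogL : Real.log L ≤ L := (Real.log_le_sub_one_of_pos hL0).trans (by linarith)
      have h5 : (k : ℝ) * Real.log 2 ≤ 5 * L := by linarith
      have hlog2 : (1 / 2 : ℝ) ≤ Real.log 2 := by linarith [Real.log_two_gt_d9]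
      have hk0 : (0 : ℝ) ≤ k := Nat.cast_nonneg _
      nlinarith
  have hk11 : (k : ℝ) + 1 ≤ 11 * L := by linarith
  have hk0 : (0 : ℝ) ≤ (k : ℝ) + 1 := by positivity
  calc ((((k + 1) ^ 2 : ℕ)) : ℝ) = ((k : ℝ) + 1) ^ 2 := by push_cast; ring
    _ ≤ (11 * L) ^ 2 := pow_le_pow_left₀ hk0 hk11 2
    _ = 121 * L ^ 2 := by ring

/-- **The scale in ledger currency**: `q̂ ≤ log²q · mainScaleReal Δ′ q` for `q ≥ 40`, `1 < Δ′ ≤ 2`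
(`ms = 2ζ(2)²q̂/(Δ′²log²q̂)`, `Δ′² ≤ 4`, `log q̂ ≤ log q`, `2ζ(2)² ≥ 4`).
[cite: KowalskiMichelVanderKam2000, §6 p. 19 (second-moment display) — derivation] -/
theorem qhat_le_log_sq_mul_mainScaleReal (hq : 40 ≤ q) {Δ' : ℝ} (h1 : 1 < Δ') (h2 : Δ' ≤ 2) :
    qhat q ≤ Real.log q ^ 2 * mainScaleReal Δ' q := by
  set s : ℝ := qhat q with hs
  have hs1 : 1 < s := one_lt_qhat hq
  have hs0 : 0 < s := lt_trans one_pos hs1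
  have hlogs : 0 < Real.log s := Real.log_pos hs1
  have hL1 : 1 ≤ Real.log q := one_le_log hq
  have hms : mainScaleReal Δ' q = 2 * (π ^ 2 / 6) ^ 2 * (s / (Δ' ^ 2 * Real.log s ^ 2)) := by
    simp only [mainScaleReal, hs, qhat]
  -- `log s ≤ log q` since `s ≤ s² ≤ q`
  have hsq : s ≤ (q : ℝ) := by
    calc s ≤ s ^ 2 := by nlinarith
      _ ≤ q := qhat_sq_le q
  have hlog_le : Real.log s ≤ Real.log q := Real.log_le_log hs0 hsq
  have hden : Δ' ^ 2 * Real.log s ^ 2 ≤ 2 * (π ^ 2 / 6) ^ 2 * Real.log q ^ 2 := by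
    have hD : Δ' ^ 2 ≤ 4 := by nlinarith
    have hl2 : Real.log s ^ 2 ≤ Real.log q ^ 2 := pow_le_pow_left₀ hlogs.le hlog_le 2
    have hπ : (4 : ℝ) ≤ 2 * (π ^ 2 / 6) ^ 2 := by
      have hπ2 : (9 : ℝ) ≤ π ^ 2 := by nlinarith [Real.pi_gt_three]
      have hπ4 : (81 : ℝ) ≤ π ^ 2 * π ^ 2 := by nlinarith
      rw [show 2 * (π ^ 2 / 6) ^ 2 = π ^ 2 * π ^ 2 / 18 by ring]
      linarith
    calc Δ' ^ 2 * Real.log s ^ 2 ≤ 4 * Real.log q ^ 2 := mul_le_mul hD hl2 (by positivity) (by norm_num)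
      _ ≤ 2 * (π ^ 2 / 6) ^ 2 * Real.log q ^ 2 := mul_le_mul_of_nonneg_right hπ (by positivity)
  have hden0 : 0 < Δ' ^ 2 * Real.log s ^ 2 := by positivity
  rw [hms]
  calc s = Real.log q ^ 2 * (2 * (π ^ 2 / 6) ^ 2 * (s / (2 * (π ^ 2 / 6) ^ 2 * Real.log q ^ 2))) := by
        field_simp
    _ ≤ Real.log q ^ 2 * (2 * (π ^ 2 / 6) ^ 2 * (s / (Δ' ^ 2 * Real.log s ^ 2))) := by
        gcongr

/-- `1 + Z_b ≤ 2·log²q·q̂^{Δ′−1}` at the clean scales (`q ≥ 40`, `Δ′ ≥ 1`).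
[cite: KowalskiMichelVanderKam2000, (21)–(23) p. 12 — derivation] -/
theorem one_add_ledgerZ_scales_le (hq : 40 ≤ q) {Δ' : ℝ} (h1 : 1 ≤ Δ') :
    1 + ledgerZ q (qhat q ^ Δ') (Real.log q ^ 4) ≤ 2 * Real.log q ^ 2 * qhat q ^ (Δ' - 1) := by
  have hs1 : 1 < qhat q := one_lt_qhat hq
  have hL1 : 1 ≤ Real.log q := one_le_log hq
  have hsη1 : 1 ≤ qhat q ^ (Δ' - 1) := Real.one_le_rpow hs1.le (by linarith)
  rw [ledgerZ_scales_eq hq Δ']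
  have h2π : 2 / π ≤ 1 := by rw [div_le_one Real.pi_pos]; linarith [Real.pi_gt_three]
  have hZle : 2 / π * qhat q ^ (Δ' - 1) * Real.log q ^ 2 ≤ Real.log q ^ 2 * qhat q ^ (Δ' - 1) := by
    calc 2 / π * qhat q ^ (Δ' - 1) * Real.log q ^ 2 ≤ 1 * qhat q ^ (Δ' - 1) * Real.log q ^ 2 := by gcongr
      _ = Real.log q ^ 2 * qhat q ^ (Δ' - 1) := by ring
  have hone : (1 : ℝ) ≤ Real.log q ^ 2 * qhat q ^ (Δ' - 1) :=
    one_le_mul_of_one_le_of_one_le (one_le_pow₀ hL1) hsη1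
  linarith

/-- F3 — the `δ`-power of `ledgerRow` at the clean scales: `(Λ(q·q⁷)²(1+Z_b)²Q²)^δ ≤ 4(Λ₀+1)²·q^{27δ}`
(`Λ = (Λ₀+1)²log⁴q ≤ (Λ₀+1)²q⁴`, `(1+Z_b)² ≤ 4q⁵`, `Q² = q^{2ε₀} ≤ q²`, base `≥ 1`, `δ ≤ 1`).
[cite: KowalskiMichelVanderKam2000, (21)–(23) p. 12 — derivation] -/
theorem ledger_rpow_factor_le (hq : 40 ≤ q) {Δ' : ℝ} (h1 : 1 ≤ Δ') (h2 : Δ' ≤ 2) {δ Λ₀ ε₀ : ℝ}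
    (hδ0 : 0 ≤ δ) (hδ1 : δ ≤ 1) (hΛ₀ : 0 ≤ Λ₀) (hε₁ : ε₀ ≤ 1) :
    ((Λ₀ + 1) ^ 2 * Real.log q ^ 4 * (((q : ℝ) * ((q ^ 7 : ℕ) : ℝ)) ^ 2 *
      (1 + ledgerZ q (qhat q ^ Δ') (Real.log q ^ 4)) ^ 2 * ((q : ℝ) ^ ε₀) ^ 2)) ^ δ ≤
      4 * (Λ₀ + 1) ^ 2 * (q : ℝ) ^ (27 * δ) := by
  set s : ℝ := qhat q with hs
  set L : ℝ := Real.log q with hL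
  set Zb : ℝ := ledgerZ q (s ^ Δ') (L ^ 4) with hZb
  have hs1 : 1 < s := one_lt_qhat hq
  have hs0 : 0 < s := lt_trans one_pos hs1
  have hq0 : (0 : ℝ) < q := by exact_mod_cast (show 0 < q by omega)
  have hq1 : (1 : ℝ) ≤ q := by exact_mod_cast (show 1 ≤ q by omega)
  have hL0 : 0 < L := lt_of_lt_of_le one_pos (one_le_log hq)
  have hsq : s ^ 2 ≤ (q : ℝ) := qhat_sq_le q
  have hL_le_q : L ≤ (q : ℝ) := (Real.log_le_sub_one_of_pos hq0).trans (by linarith)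
  have hZb0 : 0 ≤ Zb := ledgerZ_nonneg _ _ _
  have h1Zb : 1 + Zb ≤ 2 * L ^ 2 * s ^ (Δ' - 1) := one_add_ledgerZ_scales_le hq h1
  have hL4 : L ^ 4 ≤ (q : ℝ) ^ 4 := pow_le_pow_left₀ hL0.le hL_le_q 4
  have hq16 : ((q : ℝ) * ((q ^ 7 : ℕ) : ℝ)) ^ 2 = (q : ℝ) ^ 16 := by push_cast; ring
  have hs2η : s ^ (2 * (Δ' - 1)) ≤ (q : ℝ) := by
    calc s ^ (2 * (Δ' - 1)) ≤ s ^ (2 : ℝ) := Real.rpow_le_rpow_of_exponent_le hs1.le (by linarith)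
      _ = s ^ 2 := by rw [show (2 : ℝ) = (2 : ℕ) by norm_num, Real.rpow_natCast]
      _ ≤ q := hsq
  have hZ2 : (1 + Zb) ^ 2 ≤ 4 * (q : ℝ) ^ 5 := by
    have hsηsq : (s ^ (Δ' - 1)) ^ 2 = s ^ (2 * (Δ' - 1)) := by
      rw [← Real.rpow_natCast, ← Real.rpow_mul hs0.le]; ring_nf
    calc (1 + Zb) ^ 2 ≤ (2 * L ^ 2 * s ^ (Δ' - 1)) ^ 2 := pow_le_pow_left₀ (by positivity) h1Zb 2
      _ = 4 * L ^ 4 * s ^ (2 * (Δ' - 1)) := by rw [← hsηsq]; ring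
      _ ≤ 4 * (q : ℝ) ^ 4 * q := by gcongr
      _ = 4 * (q : ℝ) ^ 5 := by ring
  have hQ2 : ((q : ℝ) ^ ε₀) ^ 2 ≤ (q : ℝ) ^ 2 := by
    rw [← Real.rpow_natCast, ← Real.rpow_mul hq0.le]
    calc (q : ℝ) ^ (ε₀ * (2 : ℕ)) ≤ (q : ℝ) ^ (2 : ℝ) :=
          Real.rpow_le_rpow_of_exponent_le hq1 (by push_cast; linarith)
      _ = (q : ℝ) ^ 2 := by rw [show (2 : ℝ) = (2 : ℕ) by norm_num, Real.rpow_natCast]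
  have hbase_le : (Λ₀ + 1) ^ 2 * L ^ 4 * (((q : ℝ) * ((q ^ 7 : ℕ) : ℝ)) ^ 2 * (1 + Zb) ^ 2 *
      ((q : ℝ) ^ ε₀) ^ 2) ≤ 4 * (Λ₀ + 1) ^ 2 * (q : ℝ) ^ 27 := by
    rw [hq16]
    calc (Λ₀ + 1) ^ 2 * L ^ 4 * ((q : ℝ) ^ 16 * (1 + Zb) ^ 2 * ((q : ℝ) ^ ε₀) ^ 2)
        ≤ (Λ₀ + 1) ^ 2 * (q : ℝ) ^ 4 * ((q : ℝ) ^ 16 * (4 * (q : ℝ) ^ 5) * (q : ℝ) ^ 2) := by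
          gcongr
      _ = 4 * (Λ₀ + 1) ^ 2 * (q : ℝ) ^ 27 := by ring
  have hbase0 : 0 ≤ (Λ₀ + 1) ^ 2 * L ^ 4 * (((q : ℝ) * ((q ^ 7 : ℕ) : ℝ)) ^ 2 * (1 + Zb) ^ 2 *
      ((q : ℝ) ^ ε₀) ^ 2) := by positivity
  have hK1 : (1 : ℝ) ≤ 4 * (Λ₀ + 1) ^ 2 := by nlinarith
  calc _ ≤ (4 * (Λ₀ + 1) ^ 2 * (q : ℝ) ^ 27) ^ δ := Real.rpow_le_rpow hbase0 hbase_le hδ0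
    _ = (4 * (Λ₀ + 1) ^ 2) ^ δ * ((q : ℝ) ^ 27) ^ δ := Real.mul_rpow (by positivity) (by positivity)
    _ ≤ (4 * (Λ₀ + 1) ^ 2) ^ (1 : ℝ) * ((q : ℝ) ^ 27) ^ δ :=
        mul_le_mul_of_nonneg_right (Real.rpow_le_rpow_of_exponent_le hK1 hδ1) (by positivity)
    _ = 4 * (Λ₀ + 1) ^ 2 * (q : ℝ) ^ (27 * δ) := by
        rw [Real.rpow_one, ← Real.rpow_natCast (q : ℝ) 27, ← Real.rpow_mul hq0.le]; norm_num

/-- F4 — the density factor of `ledgerRow` at the clean scales: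
`2ΛQ²(1+Z_b)^{1/2} + 4q̂²log⁴q/q ≤ (4(Λ₀+1)²+1)·log⁵q·Q²·q̂^{(Δ′−1)/2}` (`(1+Z_b)^{1/2} ≤ 2·log q·q̂^{(Δ′−1)/2}`,
`4q̂² ≤ q`). [cite: KowalskiMichelVanderKam2000, (21)–(23) p. 12 — derivation] -/
theorem ledger_density_factor_le (hq : 40 ≤ q) {Δ' : ℝ} (h1 : 1 ≤ Δ') {Λ₀ ε₀ : ℝ} (hε₀ : 0 ≤ ε₀) :
    2 * ((Λ₀ + 1) ^ 2 * Real.log q ^ 4) * ((q : ℝ) ^ ε₀) ^ 2 *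
        (1 + ledgerZ q (qhat q ^ Δ') (Real.log q ^ 4)) ^ (1 / 2 : ℝ) +
      4 * qhat q ^ 2 * Real.log q ^ 4 / q ≤
    (4 * (Λ₀ + 1) ^ 2 + 1) * Real.log q ^ 5 * ((q : ℝ) ^ ε₀) ^ 2 * qhat q ^ ((Δ' - 1) / 2) := by
  set s : ℝ := qhat q with hs
  set L : ℝ := Real.log q with hL
  set Zb : ℝ := ledgerZ q (s ^ Δ') (L ^ 4) with hZb
  have hs1 : 1 < s := one_lt_qhat hq
  have hs0 : 0 < s := lt_trans one_pos hs1
  have hq0 : (0 : ℝ) < q := by exact_mod_cast (show 0 < q by omega)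
  have hq1 : (1 : ℝ) ≤ q := by exact_mod_cast (show 1 ≤ q by omega)
  have hL1 : 1 ≤ L := one_le_log hq
  have hL0 : 0 < L := lt_of_lt_of_le one_pos hL1
  have hZb0 : 0 ≤ Zb := ledgerZ_nonneg _ _ _
  have h1Zb : 1 + Zb ≤ 2 * L ^ 2 * s ^ (Δ' - 1) := one_add_ledgerZ_scales_le hq h1
  have hsη1 : 1 ≤ s ^ (Δ' - 1) := Real.one_le_rpow hs1.le (by linarith)
  have hsη2 : 1 ≤ s ^ ((Δ' - 1) / 2) := Real.one_le_rpow hs1.le (by linarith)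
  have hQ1 : (1 : ℝ) ≤ (q : ℝ) ^ ε₀ := Real.one_le_rpow hq1 hε₀
  have hsqrtZ : (1 + Zb) ^ (1 / 2 : ℝ) ≤ 2 * L * s ^ ((Δ' - 1) / 2) := by
    rw [← Real.sqrt_eq_rpow, Real.sqrt_le_iff]
    refine ⟨by positivity, ?_⟩
    have hsηsq : (s ^ ((Δ' - 1) / 2)) ^ 2 = s ^ (Δ' - 1) := by
      rw [← Real.rpow_natCast, ← Real.rpow_mul hs0.le]; ring_nf
    have h24 : 2 * L ^ 2 * s ^ (Δ' - 1) ≤ 4 * L ^ 2 * s ^ (Δ' - 1) :=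
      mul_le_mul_of_nonneg_right (by nlinarith [sq_nonneg L]) (by positivity)
    calc 1 + Zb ≤ 2 * L ^ 2 * s ^ (Δ' - 1) := h1Zb
      _ ≤ 4 * L ^ 2 * s ^ (Δ' - 1) := h24
      _ = (2 * L * s ^ ((Δ' - 1) / 2)) ^ 2 := by rw [← hsηsq]; ring
  have hlast : 4 * s ^ 2 * L ^ 4 / q ≤ L ^ 4 := by
    have h4s : 4 * s ^ 2 ≤ (q : ℝ) := by
      rw [hs, ← two_pi_mul_qhat_sq q, show (2 * π * qhat q) ^ 2 = π ^ 2 * (4 * qhat q ^ 2) by ring]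
      have hπ : (1 : ℝ) ≤ π ^ 2 := by nlinarith [Real.pi_gt_three]
      exact le_mul_of_one_le_left (by positivity) hπ
    rw [div_le_iff₀ hq0]
    calc 4 * s ^ 2 * L ^ 4 = L ^ 4 * (4 * s ^ 2) := by ring
      _ ≤ L ^ 4 * q := mul_le_mul_of_nonneg_left h4s (by positivity)
  have hL45 : L ^ 4 ≤ L ^ 5 * ((q : ℝ) ^ ε₀) ^ 2 * s ^ ((Δ' - 1) / 2) := by
    have hL5 : L ^ 4 ≤ L ^ 5 := by
      calc L ^ 4 = 1 * L ^ 4 := (one_mul _).symm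
        _ ≤ L * L ^ 4 := mul_le_mul_of_nonneg_right hL1 (by positivity)
        _ = L ^ 5 := by ring
    calc L ^ 4 ≤ L ^ 5 := hL5
      _ ≤ L ^ 5 * (((q : ℝ) ^ ε₀) ^ 2 * s ^ ((Δ' - 1) / 2)) :=
          le_mul_of_one_le_right (by positivity) (one_le_mul_of_one_le_of_one_le (one_le_pow₀ hQ1) hsη2)
      _ = L ^ 5 * ((q : ℝ) ^ ε₀) ^ 2 * s ^ ((Δ' - 1) / 2) := by ring
  calc 2 * ((Λ₀ + 1) ^ 2 * L ^ 4) * ((q : ℝ) ^ ε₀) ^ 2 * (1 + Zb) ^ (1 / 2 : ℝ) + 4 * s ^ 2 * L ^ 4 / q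
      ≤ 2 * ((Λ₀ + 1) ^ 2 * L ^ 4) * ((q : ℝ) ^ ε₀) ^ 2 * (2 * L * s ^ ((Δ' - 1) / 2)) + L ^ 4 :=
        add_le_add (mul_le_mul_of_nonneg_left hsqrtZ (by positivity)) hlast
    _ ≤ 2 * ((Λ₀ + 1) ^ 2 * L ^ 4) * ((q : ℝ) ^ ε₀) ^ 2 * (2 * L * s ^ ((Δ' - 1) / 2)) +
          L ^ 5 * ((q : ℝ) ^ ε₀) ^ 2 * s ^ ((Δ' - 1) / 2) := add_le_add le_rfl hL45
    _ = (4 * (Λ₀ + 1) ^ 2 + 1) * L ^ 5 * ((q : ℝ) ^ ε₀) ^ 2 * s ^ ((Δ' - 1) / 2) := by ring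

/-- **`ledgerRow` at the clean scales**:
`ledgerRow(q, q̂^{Δ′}, q⁷, log⁴q, (Λ₀+1)²log⁴q, q^{ε₀}, δ, C) ≤ 2520π·(8C(Λ₀+1)²q^{27δ})·((4(Λ₀+1)²+1)log⁵q·q^{2ε₀}… )`
— precisely the product of `ledger_rpow_factor_le` and `ledger_density_factor_le`.
[cite: KowalskiMichelVanderKam2000, (21)–(23) p. 12 — derivation] -/
theorem ledgerRow_scales_le (hq : 40 ≤ q) {Δ' : ℝ} (h1 : 1 ≤ Δ') (h2 : Δ' ≤ 2) {C δ Λ₀ ε₀ : ℝ}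
    (hC : 0 ≤ C) (hδ0 : 0 ≤ δ) (hδ1 : δ ≤ 1) (hΛ₀ : 0 ≤ Λ₀) (hε₀ : 0 ≤ ε₀) (hε₁ : ε₀ ≤ 1) :
    ledgerRow q (qhat q ^ Δ') ((q ^ 7 : ℕ) : ℝ) (Real.log q ^ 4) ((Λ₀ + 1) ^ 2 * Real.log q ^ 4)
        ((q : ℝ) ^ ε₀) δ C ≤
      2520 * π * (2 * C * (4 * (Λ₀ + 1) ^ 2 * (q : ℝ) ^ (27 * δ))) *
        ((4 * (Λ₀ + 1) ^ 2 + 1) * Real.log q ^ 5 * ((q : ℝ) ^ ε₀) ^ 2 * qhat q ^ ((Δ' - 1) / 2)) := by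
  have hF3 := ledger_rpow_factor_le hq h1 h2 hδ0 hδ1 hΛ₀ hε₁
  have hF4 := ledger_density_factor_le hq h1 hε₀ (Λ₀ := Λ₀)
  have hZb0 := ledgerZ_nonneg q (qhat q ^ Δ') (Real.log q ^ 4)
  have hs0 : 0 ≤ qhat q := (lt_trans one_pos (one_lt_qhat hq)).le
  unfold ledgerRow
  have hF40 : 0 ≤ 2 * ((Λ₀ + 1) ^ 2 * Real.log q ^ 4) * ((q : ℝ) ^ ε₀) ^ 2 *
      (1 + ledgerZ q (qhat q ^ Δ') (Real.log q ^ 4)) ^ (1 / 2 : ℝ) +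
      4 * qhat q ^ 2 * Real.log q ^ 4 / q := by positivity
  exact mul_le_mul (mul_le_mul_of_nonneg_left (mul_le_mul_of_nonneg_left hF3 (by positivity))
    (by positivity)) hF4 hF40 (by positivity)

end Summit.Parity.GeneralizedHardyLittlewood.Theorems.BeyondDiagonalBeatsQuarter.OffDiag
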